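import Mathlib.LinearAlgebra.Matrix.NonsingularInverse
import Mathlib.Data.Matrix.ColumnRowPartitioned
import Mathlib.Tactic.Abel

/-!
# T-TEL (telescoping identity) line, helper 2 — THE ONE-STEP JET MAP OF THE EFFECTIVE FORM IN CLOSED «DRESSED» FORM: every jet of the
# Schur complement is the two-leg dressing of the same jet of the full form by the FROZEN responses, and the second jet carries in addition
# (minus) a BUBBLE of dressed first jets through the fluctuation resolvent — the exact linear part and the exact quadratic correction

Helper for crux K2⁷ `EndpointGivenBR13SepCoPH` = stmt-QuantumFields-20543 (route `BalabanUVNodes`), seat `d1-tel-1` gen 0 (director-ym R576-ym (D)(2) ∕ g18 (b);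
lens «flow-gronwall-ttel» of R582-ym (3) reads T-TEL «as the EXACT linear part»).  Companion of helper 1 `BalabanUVNodesK2D1TelSchurQuotient` (p782298 ✓; not imported — this file is Mathlib-only):
there, ONE STEP = the Schur complement `M/D = A + B·W` (`D·W = −C`) = the response-graph congruence `[1|V]·M·[1;W]`, and TWO STEPS = ONE STEP.  Here the
BACKGROUND DEPENDENCE is expanded to second order.  PURE ALGEBRA over a commutative ring, calculus-free: the jets enter only through the LEIBNIZ RELATIONS
they satisfy (product rule for `D·W = −C` and `S = A + B·W` to order 2, with the binomial `2`), so the statements are consumed verbatim by any calculus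
layer (curves `s ↦ M(s)` via `HasDerivAt` product rules — e.g. `D1BFx.SliceTransferModel.hasDerivAt_matMul` — or formal power series ∕ truncated
polynomial rings).  0 `def`, 0 `sorry`; [folklore] throughout.

DATA.  Block jets `Mₖ = [[Aₖ, Bₖ],[Cₖ, Dₖ]]`, `k = 0, 1, 2` (value, first, second jet of the full form on (retained `α`) ⊕ (integrated `δ`)); response jets
`W₀, W₁, W₂ : δ × α` with the Leibniz relations of `D·W = −C`:
  (R0) `D₀W₀ = −C₀`, (R1) `D₀W₁ + D₁W₀ = −C₁`, (R2) `D₀W₂ + 2·D₁W₁ + D₂W₀ = −C₂`;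
a frozen LEFT response `V₀ : α × δ`, `V₀D₀ = −B₀` (`= W₀ᵀ` in the symmetric case); the jets of the effective form `S = A + B·W` by Leibniz:
  `S₀ = A₀ + B₀W₀`, `S₁ = A₁ + B₁W₀ + B₀W₁`, `S₂ = A₂ + B₂W₀ + 2·B₁W₁ + B₀W₂`.

WHAT IS PROVED.
* §1 `response_firstJet_eq` ∕ `response_secondJet_eq` — the response jets solved through the frozen fluctuation resolvent `D₀⁻¹` (for `D₀` non-degenerate):
  `W₁ = −D₀⁻¹(C₁ + D₁W₀)`, `W₂ = −D₀⁻¹(C₂ + 2·D₁W₁ + D₂W₀)`.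
* §2 THE DRESSED FORM OF THE JETS (no non-degeneracy needed beyond the relations): `dressed_eq_blocks` (`[1|V]·M·[1;W] = A + B·W + V·C + V·D·W`),
  `leftVertex_eq` ∕ `rightVertex_eq` (the off-diagonal read-outs `[1|V₀]·M₁·[0;1] = B₁ + V₀D₁`, `[0|1]·M₁·[1;W₀] = C₁ + D₁W₀` — the DRESSED FIRST-ORDER
  VERTICES), ★ `schur_firstJet_eq_dressed` (`S₁ = [1|V₀]·M₁·[1;W₀]` — the first jet of the effective form is the dressed first jet of the full form: the
  response's own first jet drops out), ★★ `schur_secondJet_eq_dressed_add` (`S₂ = [1|V₀]·M₂·[1;W₀] + 2·(B₁ + V₀D₁)·W₁` — EXACT: the part LINEAR in the second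
  jets is the two-leg dressing by the frozen responses, the remainder is bilinear in first jets), ★★ `schur_secondJet_eq_dressed_sub_bubble` (for `D₀`
  non-degenerate: `S₂ = [1|V₀]·M₂·[1;W₀] − 2·(B₁ + V₀D₁)·D₀⁻¹·(C₁ + D₁W₀)` — DRESSED SECOND JET MINUS A BUBBLE of the dressed first-order vertices through
  the frozen fluctuation resolvent: the «tadpole − bubble» shape of the one-loop kernel `ExpKernelCalculus.hessKer` and of the second-order table recursion
  (T2-REC) ∕ `GAN24.T2RecursionAffine.lin4`, here at the level of the quadratic form itself).
* §3 `schur_jets_telescope_shape` — packaging: the triple `(S₀, S₁, S₂)` in the two displayed shapes side by side (value = `M₀/D₀`, first jet dressed,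
  second jet dressed − bubble), the statement a kernel-level dictionary instantiates entrywise.

HONEST FRAMING.  Textbook algebra (implicit differentiation of `D·W = −C`), kernel-checked; it asserts nothing about Bałaban's kernels, tables or jets; the
kernel-level dictionary (signature (S3) `StubDictionary` of `Cruxes/EndpointGivenBR13SepCoPH/D1TelSignatures.lean` = `TshotOf Lc Jc 1 = TbalOf Lc Js 0 ∧
StepRecursion Lc (TbalOf Lc Js) (TshotOf Lc Jc) (wStep Lc)`) is OPEN (LAYER 2, road «FP» route T); `D1Tel`, K2⁷, `BetaPertH` NOT proved; NOT continuum, NOT OS,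
NOT Clay; the Yang–Mills mass gap is NOT proved.
-/

namespace Summit.QuantumFields.YangMills.Theorems.BalabanUVNodesK2D1TelSchurJets

open Matrix

variable {𝕜 : Type*} [CommRing 𝕜]
variable {α δ : Type*} [Fintype α] [Fintype δ] [DecidableEq α] [DecidableEq δ]

/-! ## §1 The response jets through the frozen fluctuation resolvent -/

omit [Fintype α] [DecidableEq α] in
/-- [folklore] **FIRST RESPONSE JET**: from (R1) `D₀W₁ + D₁W₀ = −C₁` and `D₀` non-degenerate, `W₁ = −D₀⁻¹·(C₁ + D₁W₀)` (the frozen resolvent applied to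
the dressed first-order vertex). -/
theorem response_firstJet_eq (C₁ : Matrix δ α 𝕜) (D₀ D₁ : Matrix δ δ 𝕜) (W₀ W₁ : Matrix δ α 𝕜) (hD : IsUnit D₀.det)
    (hW₁ : D₀ * W₁ + D₁ * W₀ = -C₁) : W₁ = -(D₀⁻¹ * (C₁ + D₁ * W₀)) := by
  have h : D₀ * W₁ = -(C₁ + D₁ * W₀) := by
    rw [eq_sub_of_add_eq hW₁]
    abel
  calc W₁ = D₀⁻¹ * (D₀ * W₁) := by rw [← Matrix.mul_assoc, Matrix.nonsing_inv_mul D₀ hD, Matrix.one_mul]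
  _ = -(D₀⁻¹ * (C₁ + D₁ * W₀)) := by rw [h, Matrix.mul_neg]

omit [Fintype α] [DecidableEq α] in
/-- [folklore] **SECOND RESPONSE JET**: from (R2) `D₀W₂ + 2·D₁W₁ + D₂W₀ = −C₂` and `D₀` non-degenerate, `W₂ = −D₀⁻¹·(C₂ + 2·D₁W₁ + D₂W₀)`. -/
theorem response_secondJet_eq (C₂ : Matrix δ α 𝕜) (D₀ D₁ D₂ : Matrix δ δ 𝕜) (W₀ W₁ W₂ : Matrix δ α 𝕜) (hD : IsUnit D₀.det)
    (hW₂ : D₀ * W₂ + 2 • (D₁ * W₁) + D₂ * W₀ = -C₂) : W₂ = -(D₀⁻¹ * (C₂ + 2 • (D₁ * W₁) + D₂ * W₀)) := by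
  have h : D₀ * W₂ = -(C₂ + 2 • (D₁ * W₁) + D₂ * W₀) := by
    rw [eq_sub_of_add_eq (eq_sub_of_add_eq hW₂)]
    abel
  calc W₂ = D₀⁻¹ * (D₀ * W₂) := by rw [← Matrix.mul_assoc, Matrix.nonsing_inv_mul D₀ hD, Matrix.one_mul]
  _ = -(D₀⁻¹ * (C₂ + 2 • (D₁ * W₁) + D₂ * W₀)) := by rw [h, Matrix.mul_neg]

/-! ## §2 The jets of the effective form in dressed form -/

omit [DecidableEq δ] in
/-- [folklore] The two-leg dressing spelled out in blocks: `[1|V]·[[A,B],[C,D]]·[1;W] = A + B·W + V·C + V·D·W`. -/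
theorem dressed_eq_blocks (A : Matrix α α 𝕜) (B : Matrix α δ 𝕜) (C : Matrix δ α 𝕜) (D : Matrix δ δ 𝕜) (V : Matrix α δ 𝕜) (W : Matrix δ α 𝕜) :
    fromCols (1 : Matrix α α 𝕜) V * fromBlocks A B C D * fromRows (1 : Matrix α α 𝕜) W = A + B * W + V * C + V * D * W := by
  rw [Matrix.mul_assoc, fromBlocks_mul_fromRows, fromCols_mul_fromRows, Matrix.one_mul, Matrix.mul_one, Matrix.mul_one, Matrix.mul_add,
    Matrix.mul_assoc]
  abel

/-- [folklore] **LEFT DRESSED FIRST-ORDER VERTEX**: the (retained → integrated) read-out of a dressed jet, `[1|V₀]·[[A₁,B₁],[C₁,D₁]]·[0;1] = B₁ + V₀·D₁`. -/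
theorem leftVertex_eq (A₁ : Matrix α α 𝕜) (B₁ : Matrix α δ 𝕜) (C₁ : Matrix δ α 𝕜) (D₁ : Matrix δ δ 𝕜) (V₀ : Matrix α δ 𝕜) :
    fromCols (1 : Matrix α α 𝕜) V₀ * fromBlocks A₁ B₁ C₁ D₁ * fromRows (0 : Matrix α δ 𝕜) (1 : Matrix δ δ 𝕜) = B₁ + V₀ * D₁ := by
  rw [fromCols_mul_fromBlocks, fromCols_mul_fromRows, Matrix.mul_zero, zero_add, Matrix.mul_one, Matrix.one_mul]

/-- [folklore] **RIGHT DRESSED FIRST-ORDER VERTEX**: the (integrated ← retained) read-out, `[0|1]·[[A₁,B₁],[C₁,D₁]]·[1;W₀] = C₁ + D₁·W₀`. -/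
theorem rightVertex_eq (A₁ : Matrix α α 𝕜) (B₁ : Matrix α δ 𝕜) (C₁ : Matrix δ α 𝕜) (D₁ : Matrix δ δ 𝕜) (W₀ : Matrix δ α 𝕜) :
    fromCols (0 : Matrix δ α 𝕜) (1 : Matrix δ δ 𝕜) * fromBlocks A₁ B₁ C₁ D₁ * fromRows (1 : Matrix α α 𝕜) W₀ = C₁ + D₁ * W₀ := by
  rw [Matrix.mul_assoc, fromBlocks_mul_fromRows, fromCols_mul_fromRows, Matrix.zero_mul, zero_add, Matrix.one_mul, Matrix.mul_one]

omit [DecidableEq δ] in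
/-- [folklore] ★ **THE FIRST JET OF THE EFFECTIVE FORM IS THE DRESSED FIRST JET OF THE FULL FORM**: with (R1) and the frozen left response `V₀D₀ = −B₀`,
`S₁ = A₁ + B₁W₀ + B₀W₁ = [1|V₀]·M₁·[1;W₀]` — the response's own first jet `W₁` drops out (stationarity).  No non-degeneracy needed. -/
theorem schur_firstJet_eq_dressed (A₁ : Matrix α α 𝕜) (B₀ B₁ : Matrix α δ 𝕜) (C₁ : Matrix δ α 𝕜) (D₀ D₁ : Matrix δ δ 𝕜)
    (V₀ : Matrix α δ 𝕜) (W₀ W₁ : Matrix δ α 𝕜) (hV₀ : V₀ * D₀ = -B₀) (hW₁ : D₀ * W₁ + D₁ * W₀ = -C₁) :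
    A₁ + B₁ * W₀ + B₀ * W₁ = fromCols (1 : Matrix α α 𝕜) V₀ * fromBlocks A₁ B₁ C₁ D₁ * fromRows (1 : Matrix α α 𝕜) W₀ := by
  have hC₁ : C₁ = -(D₀ * W₁ + D₁ * W₀) := by rw [hW₁, neg_neg]
  have hB₀ : B₀ * W₁ = -(V₀ * D₀ * W₁) := by rw [hV₀, Matrix.neg_mul, neg_neg]
  rw [dressed_eq_blocks, hC₁, hB₀, Matrix.mul_neg, Matrix.mul_add, Matrix.mul_assoc, Matrix.mul_assoc]
  abel

omit [DecidableEq δ] in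
/-- [folklore] ★★ **THE SECOND JET OF THE EFFECTIVE FORM, EXACT FORM**: with (R1), (R2) and `V₀D₀ = −B₀`,
`S₂ = A₂ + B₂W₀ + 2·B₁W₁ + B₀W₂ = [1|V₀]·M₂·[1;W₀] + 2·(B₁ + V₀D₁)·W₁` — the part LINEAR IN THE SECOND JETS `(A₂, B₂, C₂, D₂)` is the two-leg dressing
by the FROZEN responses (the exact linear part of the one-step jet map); the rest is bilinear in first jets.  No non-degeneracy needed. -/
theorem schur_secondJet_eq_dressed_add (A₂ : Matrix α α 𝕜) (B₀ B₁ B₂ : Matrix α δ 𝕜) (C₂ : Matrix δ α 𝕜) (D₀ D₁ D₂ : Matrix δ δ 𝕜)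
    (V₀ : Matrix α δ 𝕜) (W₀ W₁ W₂ : Matrix δ α 𝕜) (hV₀ : V₀ * D₀ = -B₀) (hW₂ : D₀ * W₂ + 2 • (D₁ * W₁) + D₂ * W₀ = -C₂) :
    A₂ + B₂ * W₀ + 2 • (B₁ * W₁) + B₀ * W₂
      = fromCols (1 : Matrix α α 𝕜) V₀ * fromBlocks A₂ B₂ C₂ D₂ * fromRows (1 : Matrix α α 𝕜) W₀ + 2 • ((B₁ + V₀ * D₁) * W₁) := by
  have hC₂ : C₂ = -(D₀ * W₂ + 2 • (D₁ * W₁) + D₂ * W₀) := by rw [hW₂, neg_neg]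
  have hB₀ : B₀ * W₂ = -(V₀ * D₀ * W₂) := by rw [hV₀, Matrix.neg_mul, neg_neg]
  rw [dressed_eq_blocks, hC₂, hB₀, Matrix.mul_neg, Matrix.mul_add, Matrix.mul_add, Matrix.mul_smul, Matrix.add_mul, smul_add,
    Matrix.mul_assoc, Matrix.mul_assoc, Matrix.mul_assoc]
  abel

/-- [folklore] ★★ **THE SECOND JET OF THE EFFECTIVE FORM = DRESSED SECOND JET MINUS A BUBBLE**: for `D₀` non-degenerate, with (R1), (R2) and `V₀D₀ = −B₀`,
`S₂ = [1|V₀]·M₂·[1;W₀] − 2·(B₁ + V₀D₁)·D₀⁻¹·(C₁ + D₁W₀)` — the dressed second jet (tadpole-like) minus the BUBBLE of the two dressed first-order vertices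
(`leftVertex_eq` ∕ `rightVertex_eq`) through the frozen fluctuation resolvent `D₀⁻¹`: the «½·tadpole − ½·bubble» shape of `ExpKernelCalculus.hessKer`
and the affine shape (T2-REC) ∕ `lin4` of the typed second-order table recursion, at the level of the quadratic form. -/
theorem schur_secondJet_eq_dressed_sub_bubble (A₂ : Matrix α α 𝕜) (B₀ B₁ B₂ : Matrix α δ 𝕜) (C₁ C₂ : Matrix δ α 𝕜) (D₀ D₁ D₂ : Matrix δ δ 𝕜)
    (V₀ : Matrix α δ 𝕜) (W₀ W₁ W₂ : Matrix δ α 𝕜) (hD : IsUnit D₀.det) (hV₀ : V₀ * D₀ = -B₀)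
    (hW₁ : D₀ * W₁ + D₁ * W₀ = -C₁) (hW₂ : D₀ * W₂ + 2 • (D₁ * W₁) + D₂ * W₀ = -C₂) :
    A₂ + B₂ * W₀ + 2 • (B₁ * W₁) + B₀ * W₂
      = fromCols (1 : Matrix α α 𝕜) V₀ * fromBlocks A₂ B₂ C₂ D₂ * fromRows (1 : Matrix α α 𝕜) W₀
        - 2 • ((B₁ + V₀ * D₁) * D₀⁻¹ * (C₁ + D₁ * W₀)) := by
  rw [schur_secondJet_eq_dressed_add A₂ B₀ B₁ B₂ C₂ D₀ D₁ D₂ V₀ W₀ W₁ W₂ hV₀ hW₂, response_firstJet_eq C₁ D₀ D₁ W₀ W₁ hD hW₁, Matrix.mul_neg,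
    smul_neg, ← Matrix.mul_assoc, sub_eq_add_neg]

/-! ## §3 Packaging: value, first and second jet of one step side by side -/

/-- [folklore] **THE ONE-STEP JET MAP (orders 0, 1, 2) IN CLOSED FORM.**  For `D₀` non-degenerate, frozen responses `D₀W₀ = −C₀`, `V₀D₀ = −B₀`, and response
jets with the Leibniz relations (R1), (R2): the value of the effective form is the Schur complement `A₀ − B₀D₀⁻¹C₀`, its first jet is the dressed first jet,
its second jet is the dressed second jet minus the bubble of dressed first-order vertices — the statement a kernel-level dictionary instantiates entrywise
(one step of `HessianTelescopingKKT.StepRecursion`: transport on both legs + the step's own term). -/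
theorem schur_jets_telescope_shape (A₀ A₁ A₂ : Matrix α α 𝕜) (B₀ B₁ B₂ : Matrix α δ 𝕜) (C₀ C₁ C₂ : Matrix δ α 𝕜) (D₀ D₁ D₂ : Matrix δ δ 𝕜)
    (V₀ : Matrix α δ 𝕜) (W₀ W₁ W₂ : Matrix δ α 𝕜) (hD : IsUnit D₀.det) (hV₀ : V₀ * D₀ = -B₀) (hW₀ : D₀ * W₀ = -C₀)
    (hW₁ : D₀ * W₁ + D₁ * W₀ = -C₁) (hW₂ : D₀ * W₂ + 2 • (D₁ * W₁) + D₂ * W₀ = -C₂) :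
    A₀ + B₀ * W₀ = A₀ - B₀ * D₀⁻¹ * C₀
    ∧ A₁ + B₁ * W₀ + B₀ * W₁ = fromCols (1 : Matrix α α 𝕜) V₀ * fromBlocks A₁ B₁ C₁ D₁ * fromRows (1 : Matrix α α 𝕜) W₀
    ∧ A₂ + B₂ * W₀ + 2 • (B₁ * W₁) + B₀ * W₂
        = fromCols (1 : Matrix α α 𝕜) V₀ * fromBlocks A₂ B₂ C₂ D₂ * fromRows (1 : Matrix α α 𝕜) W₀
          - 2 • ((B₁ + V₀ * D₁) * D₀⁻¹ * (C₁ + D₁ * W₀)) :=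
  by
  refine ⟨?_, schur_firstJet_eq_dressed A₁ B₀ B₁ C₁ D₀ D₁ V₀ W₀ W₁ hV₀ hW₁,
    schur_secondJet_eq_dressed_sub_bubble A₂ B₀ B₁ B₂ C₁ C₂ D₀ D₁ D₂ V₀ W₀ W₁ W₂ hD hV₀ hW₁ hW₂⟩
  -- the value: `W₀ = −D₀⁻¹C₀` (helper 1's `schur_eq_add_mul_response`, inlined to keep this file import-light)
  have hW' : W₀ = -(D₀⁻¹ * C₀) := by
    calc W₀ = D₀⁻¹ * (D₀ * W₀) := by rw [← Matrix.mul_assoc, Matrix.nonsing_inv_mul D₀ hD, Matrix.one_mul]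
    _ = -(D₀⁻¹ * C₀) := by rw [hW₀, Matrix.mul_neg]
  rw [hW', Matrix.mul_neg, ← Matrix.mul_assoc, sub_eq_add_neg]

end Summit.QuantumFields.YangMills.Theorems.BalabanUVNodesK2D1TelSchurJets
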